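/-
Copyright (c) 2026 the pub-hodgecm-mathlib formalisation cell (harness21).  Prover seat hodgecm-mathlib-LH4-p01 (g11): half-A line LH4, (L2-6)-dy «2-deep representatives by
COUNTING», arithmetic brick «the printed closed forms are POSITIVE»; 2026-09-03.
-/
import Literature.NumberTheory.Rogawski1990.UnitOrbitalIntegralInertClosedFormsTypeTwo
import HarnessLib

/-!
# Flicker's type-(2) unit orbital integrals at an inert place are POSITIVE (Canad. J. Math. 50 (1998), Prop. 11 p. 87, Prop. 17 p. 97)

Topic `NumberTheory/Rogawski1990`; namespace `Literature.NumberTheory.Rogawski1990.Flicker1998`.  THEOREMS ONLY (no definition, no instance, no notation, no named fact,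
no `sorry`); kernel lane `--supports stmt-HodgeConjecture-24833`.  Cell `pub/hodgecm-mathlib` (D-0151), crux H413 = `stmt-HodgeConjecture-24833`, half-A line LH4, organ
(L2-6)-dy «2-deep representatives of the charged type-(2) classes by COUNTING»: a charged class has a level-two representative in `K′` iff its level-two coset count is
`> 0`, and that count is `Φ_{n−4}(N−2)` ∕ `Φ′_{n−4}(N−2)` ((B2g)); this file proves the elementary positivity of ★ B-p14's printed closed forms (`UnitOrbitalIntegralInertClosedFormsTypeTwo`):
for `q ≥ 2`, `phiTHM q M N > 0` for all `(M, N)`; `phiTHprimeM q M N > 0` for `M ≥ 1` (it is `0` at `M = 0`); hence `phiTHn q n N > 0`, and `phiTHprimen q n N > 0` for `n ≥ 2`.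
Pure arithmetic of the printed rational functions (they are lattice counts, [Flicker1998UnitaryFL, Prop. 11, Prop. 17]); no letter is paid by this file alone.
HONEST LABEL: HC_CM is proved only modulo the 7 printed citations (2 remaining: hLiu418 = stmt-HodgeConjecture-24832, h413 = stmt-HodgeConjecture-24833) until rung 0 closes.

## References
* [Flicker1998UnitaryFL] Y. Z. Flicker, *Elementary proof of the fundamental lemma for a unitary group*, Canad. J. Math. 50 (1998): Prop. 11 p. 87, Props. 16–17 pp. 96–97, Theorem 18 p. 97.
* [Rogawski1990] J. D. Rogawski, *Automorphic Representations of Unitary Groups in Three Variables*, Ann. of Math. Stud. 123 (1990): §4.9 Prop. 4.9.1 (b) p. 55.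
-/

namespace Literature.NumberTheory.Rogawski1990.Flicker1998

/-! ## §1 `Φ` (class `κ = +1`) -/

/-- **`phiTHM q M N > 0` for `q ≥ 2`** (all four printed branches of Prop. 11, second half). [cite: Flicker1998UnitaryFL, Prop. 11 p. 87] -/
theorem phiTHM_pos {q : ℕ} (hq : 2 ≤ q) (M N : ℕ) : 0 < phiTHM q M N := by
  have hQ : (2 : ℚ) ≤ (q : ℚ) := by exact_mod_cast hq
  have hQ1 : (0 : ℚ) < (q : ℚ) - 1 := by linarith
  have hD : (0 : ℚ) < ((q : ℚ) ^ 2 + 1) * ((q : ℚ) - 1) := mul_pos (by positivity) hQ1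
  have hQ1' : (1 : ℚ) ≤ (q : ℚ) := by linarith
  have hpow1 : ∀ k : ℕ, (1 : ℚ) ≤ (q : ℚ) ^ k := fun k => one_le_pow₀ hQ1'
  unfold phiTHM
  split_ifs with hNM hpar hpar'
  · -- `N < M`, `N` odd: `(q^{2N+2} − 1) ∕ D`
    refine div_pos ?_ hD
    have h := hpow1 (2 * N + 1)
    have e : (q : ℚ) ^ (2 * N + 2) = (q : ℚ) ^ (2 * N + 1) * q := by rw [pow_succ]
    nlinarith
  · -- `N < M`, `N` even: `(q^{2N+4} − 1) ∕ D − q^{1+2N}`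
    rw [sub_pos, lt_div_iff₀ hD]
    have h := hpow1 (2 * N + 1)
    have e4 : (q : ℚ) ^ (2 * N + 4) = (q : ℚ) ^ (2 * N + 1) * (q : ℚ) ^ 3 := by rw [← pow_add]
    have e1 : (q : ℚ) ^ (1 + 2 * N) = (q : ℚ) ^ (2 * N + 1) := by rw [Nat.add_comm]
    rw [e4, e1]
    nlinarith [mul_le_mul_of_nonneg_left hQ (zero_le_one.trans h), mul_nonneg (zero_le_one.trans h) (sq_nonneg ((q : ℚ) - 1))]
  · -- `M ≤ N`, `M` odd: `q^{N+2M+1} ∕ (q−1) − (q^{2M} + 1) ∕ D`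
    rw [sub_pos, div_lt_div_iff₀ hD hQ1]
    have hle : (q : ℚ) ^ (2 * M + 1) ≤ (q : ℚ) ^ (N + 2 * M + 1) := pow_le_pow_right₀ hQ1' (by omega)
    have e : (q : ℚ) ^ (2 * M + 1) = (q : ℚ) ^ (2 * M) * q := by rw [pow_succ]
    have h := hpow1 (2 * M)
    have hB : (q : ℚ) ^ (2 * M) * q ≤ (q : ℚ) ^ (N + 2 * M + 1) := by rw [← e]; exact hle
    have hB2 : 2 * (q : ℚ) ^ (2 * M) ≤ (q : ℚ) ^ (N + 2 * M + 1) := by nlinarith [hB, h, hQ]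
    have h5 : (5 : ℚ) ≤ (q : ℚ) ^ 2 + 1 := by nlinarith [hQ]
    have h1 : (q : ℚ) ^ (2 * M) + 1 < (q : ℚ) ^ (N + 2 * M + 1) * ((q : ℚ) ^ 2 + 1) :=
      calc (q : ℚ) ^ (2 * M) + 1 < 2 * (q : ℚ) ^ (2 * M) * 5 := by linarith
        _ ≤ (q : ℚ) ^ (N + 2 * M + 1) * ((q : ℚ) ^ 2 + 1) := mul_le_mul hB2 h5 (by norm_num) (by positivity)
    calc ((q : ℚ) ^ (2 * M) + 1) * ((q : ℚ) - 1) < (q : ℚ) ^ (N + 2 * M + 1) * ((q : ℚ) ^ 2 + 1) * ((q : ℚ) - 1) :=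
        mul_lt_mul_of_pos_right h1 hQ1
      _ = (q : ℚ) ^ (N + 2 * M + 1) * (((q : ℚ) ^ 2 + 1) * ((q : ℚ) - 1)) := by ring
  · -- `M ≤ N`, `M` even: `q^{N+2M+1} ∕ (q−1) − (q^{2M+2} + 1) ∕ D`
    rw [sub_pos, div_lt_div_iff₀ hD hQ1]
    have hle : (q : ℚ) ^ (2 * M + 1) ≤ (q : ℚ) ^ (N + 2 * M + 1) := pow_le_pow_right₀ hQ1' (by omega)
    have e : (q : ℚ) ^ (2 * M + 1) = (q : ℚ) ^ (2 * M) * q := by rw [pow_succ]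
    have e2 : (q : ℚ) ^ (2 * M + 2) = (q : ℚ) ^ (2 * M) * q * q := by rw [pow_succ, pow_succ]
    have h := hpow1 (2 * M)
    have hB : (q : ℚ) ^ (2 * M) * q ≤ (q : ℚ) ^ (N + 2 * M + 1) := by rw [← e]; exact hle
    -- `q^{2M+2} + 1 = (q^{2M}·q)·q + 1 < (q^{2M}·q)·(q² + 1) ≤ q^{N+2M+1}·(q² + 1)`
    have h1 : (q : ℚ) ^ (2 * M + 2) + 1 < (q : ℚ) ^ (N + 2 * M + 1) * ((q : ℚ) ^ 2 + 1) := by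
      rw [e2]
      calc (q : ℚ) ^ (2 * M) * q * q + 1 < (q : ℚ) ^ (2 * M) * q * ((q : ℚ) ^ 2 + 1) := by nlinarith [h, hQ]
        _ ≤ (q : ℚ) ^ (N + 2 * M + 1) * ((q : ℚ) ^ 2 + 1) := mul_le_mul_of_nonneg_right hB (by positivity)
    calc ((q : ℚ) ^ (2 * M + 2) + 1) * ((q : ℚ) - 1) < (q : ℚ) ^ (N + 2 * M + 1) * ((q : ℚ) ^ 2 + 1) * ((q : ℚ) - 1) :=
        mul_lt_mul_of_pos_right h1 hQ1
      _ = (q : ℚ) ^ (N + 2 * M + 1) * (((q : ℚ) ^ 2 + 1) * ((q : ℚ) - 1)) := by ring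

/-- **`phiTHn q n N > 0` for `q ≥ 2`** (`Φ` indexed by the observable exponents). [cite: Flicker1998UnitaryFL, Prop. 11 p. 87; Theorem 18 p. 97] -/
theorem phiTHn_pos {q : ℕ} (hq : 2 ≤ q) (n N : ℕ) : 0 < phiTHn q n N := by
  unfold phiTHn
  exact phiTHM_pos hq _ _

/-! ## §2 `Φ′` (class `κ = −1`) -/

/-- **`phiTHprimeM q M N ≥ 0` for `q ≥ 2`** (Prop. 17: a lattice count). [cite: Flicker1998UnitaryFL, Prop. 17 p. 97] -/
theorem phiTHprimeM_nonneg {q : ℕ} (hq : 2 ≤ q) (M N : ℕ) : 0 ≤ phiTHprimeM q M N := by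
  have hQ : (2 : ℚ) ≤ (q : ℚ) := by exact_mod_cast hq
  have hQ1 : (0 : ℚ) < (q : ℚ) - 1 := by linarith
  have hD : (0 : ℚ) < ((q : ℚ) ^ 2 + 1) * ((q : ℚ) - 1) := mul_pos (by positivity) hQ1
  have hQ1' : (1 : ℚ) ≤ (q : ℚ) := by linarith
  unfold phiTHprimeM
  refine add_nonneg (div_nonneg (sub_nonneg.2 (one_le_pow₀ hQ1')) hD.le) ?_
  split_ifs with hNM
  · refine div_nonneg (mul_nonneg (pow_nonneg (by positivity) _) (sub_nonneg.2 (pow_le_pow_right₀ hQ1' (by omega)))) hQ1.le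
  · exact le_rfl

/-- **`phiTHprimeM q M N > 0` for `q ≥ 2` and `M ≥ 1`** (at `M = 0` the value is `0`). [cite: Flicker1998UnitaryFL, Prop. 17 p. 97] -/
theorem phiTHprimeM_pos {q : ℕ} (hq : 2 ≤ q) {M : ℕ} (hM : 1 ≤ M) (N : ℕ) : 0 < phiTHprimeM q M N := by
  have hQ : (2 : ℚ) ≤ (q : ℚ) := by exact_mod_cast hq
  have hQ1 : (0 : ℚ) < (q : ℚ) - 1 := by linarith
  have hD : (0 : ℚ) < ((q : ℚ) ^ 2 + 1) * ((q : ℚ) - 1) := mul_pos (by positivity) hQ1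
  have hQ1' : (1 : ℚ) ≤ (q : ℚ) := by linarith
  unfold phiTHprimeM
  refine add_pos_of_pos_of_nonneg (div_pos (sub_pos.2 ?_) hD) ?_
  · have hk : 1 ≤ min (N / 2 + 1) ((M + 1) / 2) := le_min (by omega) (by omega)
    calc (1 : ℚ) < (q : ℚ) ^ 1 := by rw [pow_one]; linarith
      _ ≤ (q : ℚ) ^ (4 * min (N / 2 + 1) ((M + 1) / 2)) := pow_le_pow_right₀ hQ1' (by omega)
  · split_ifs with hNM
    · exact div_nonneg (mul_nonneg (pow_nonneg (by positivity) _) (sub_nonneg.2 (pow_le_pow_right₀ hQ1' (by omega)))) hQ1.le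
    · exact le_rfl

/-- **`phiTHprimen q n N > 0` for `q ≥ 2` and `n ≥ 2`** (`Φ′` indexed by the observable exponents: `M = n∕2 ≥ 1` if `n` is even, `M = N + 1 ≥ 1` otherwise).
[cite: Flicker1998UnitaryFL, Prop. 17 p. 97; Theorem 18 p. 97] -/
theorem phiTHprimen_pos {q : ℕ} (hq : 2 ≤ q) {n : ℕ} (hn : 2 ≤ n) (N : ℕ) : 0 < phiTHprimen q n N := by
  unfold phiTHprimen
  refine phiTHprimeM_pos hq ?_ N
  split_ifs with h
  · omega
  · omega

end Literature.NumberTheory.Rogawski1990.Flicker1998
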